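import Summits.ValiantsHypothesis.ValiantsHypothesis.Theorems.NewtonFramesTwoProductsFrameRungTwoBothOfOut

/-!
# Crux `TwoProducts` (stmt-5906), line `FrameRungTwo`: (IX) from the 1-D OUT kernel and the SEPARATION kernel

Capstone of the g4 reduction chain (`…ShallowNeighbourCore` p636720/p637974, `…OneD` p639382, `…CancelOneD` p639956,
`…BothOfOut` — Lemma P).  `hSep1D` (the SEPARATION kernel): in the both-IN deep–deep 1-D setting, letter weights that cancel at every
light common point other than `e` but NOT at `e` admit ADDITIVE weights `ψ, ψ'` agreeing at those points and separating the two words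
of `e`.  By the character/torsion discussion of `memo-IX-g4.md` §3, `hSep1D` holds whenever the top relation is not torsion modulo the
lower ones (and it is implied outright by `hCancel1D`, whose hypotheses it shares).  `bothKernel_of_oneD_of_sep`: `hOut1D ∧ hSep1D` ⇒
the BOTH kernel of `shallowNeighbour_of_cores` (transport to 1-D, separate, Lemma P, transport back);
`shallowNeighbour_of_out1D_of_sep1D`: `hOut1D ∧ hSep1D ⇒ hIX` of p603280 VERBATIM; `crossCancel_of_out1D_of_sep1D`: the `k = 2` count.
So the per-vertex residual of the `k = 2` layer is: the window-factorization statement `hOut1D` plus the (torsion-type) `hSep1D`.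
Honest scope: a REDUCTION for ONE stub of a rung strictly below the crux `TwoProducts`; neither kernel is proved here; nothing here
bears on `VP ≠ VNP`.  [ours; setting KPTT arXiv:1308.2286 §2, §5]
-/

set_option linter.dupNamespace false

namespace Summit.ValiantsHypothesis.ValiantsHypothesis.Theorems.NewtonFramesTwoProducts.FrameRungTwoTrinomial

open MvPolynomial
open scoped BigOperators Classical
open Summit.ValiantsHypothesis.Theorems.DissociatedFixedK (lexKey lexKey_injective)
open Summit.ValiantsHypothesis.ValiantsHypothesis.Theorems.DissociatedFixedK.Negative (emb emb_injective)
open Summit.ValiantsHypothesis.ValiantsHypothesis.Theorems.NewtonFramesTwoProducts.FrameRungTwoBinomial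
  (emb_add emb_sum apply_le_of_lexKey_le)

noncomputable section

section SepKernel

variable {m : ℕ}

/-- **The BOTH kernel from the 1-D OUT kernel and the separation kernel.** [ours] -/
theorem bothKernel_of_oneD_of_sep
    (hOut1D : ∀ (S S' : Fin m → Finset ℝ) (e : ℝ) (T T' a : Fin m → ℝ),
      (∀ b c : Fin m → ℝ, (∀ j, b j ∈ S j) → (∀ j, c j ∈ S j) → ∑ j, b j = ∑ j, c j → b = c) →
      (∀ b c : Fin m → ℝ, (∀ j, b j ∈ S' j) → (∀ j, c j ∈ S' j) → ∑ j, b j = ∑ j, c j → b = c) →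
      (∀ j, T j ∈ S j) → (∀ j, ∀ x ∈ S j, x ≤ T j) → (∀ j, T' j ∈ S' j) → (∀ j, ∀ x ∈ S' j, x ≤ T' j) →
      (∀ j, a j ∈ S j) → ∑ j, a j = e → ∑ j, T j = ∑ j, T' j → e < ∑ j, T j →
      (∀ b : Fin m → ℝ, (∀ j, b j ∈ S j) → ∑ j, b j ≠ e → e ≤ ∑ j, b j →
        ∃ c : Fin m → ℝ, (∀ j, c j ∈ S' j) ∧ ∑ j, c j = ∑ j, b j) →
      (∀ c : Fin m → ℝ, (∀ j, c j ∈ S' j) → ∑ j, c j ≠ e → e ≤ ∑ j, c j →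
        ∃ b : Fin m → ℝ, (∀ j, b j ∈ S j) ∧ ∑ j, b j = ∑ j, c j) →
      (∀ c : Fin m → ℝ, (∀ j, c j ∈ S' j) → ∑ j, c j ≠ e) →
      4 ≤ (Finset.univ.filter fun i => a i ≠ T i).card →
      ∃ (w : Fin m → ℝ) (p : Fin m) (y : ℝ), (∀ i, w i ∈ S' i) ∧
        (Finset.univ.filter fun i => w i ≠ T' i).card ≤ 2 ∧ y ∈ S' p ∧ e + T' p = ∑ i, w i + y)
    (hSep1D : ∀ (S S' : Fin m → Finset ℝ) (e : ℝ) (T T' a u : Fin m → ℝ) (cf cg : Fin m → ℝ → ℂ),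
      (∀ b c : Fin m → ℝ, (∀ j, b j ∈ S j) → (∀ j, c j ∈ S j) → ∑ j, b j = ∑ j, c j → b = c) →
      (∀ b c : Fin m → ℝ, (∀ j, b j ∈ S' j) → (∀ j, c j ∈ S' j) → ∑ j, b j = ∑ j, c j → b = c) →
      (∀ j, T j ∈ S j) → (∀ j, ∀ x ∈ S j, x ≤ T j) → (∀ j, T' j ∈ S' j) → (∀ j, ∀ x ∈ S' j, x ≤ T' j) →
      (∀ j, a j ∈ S j) → ∑ j, a j = e → (∀ j, u j ∈ S' j) → ∑ j, u j = e →
      ∑ j, T j = ∑ j, T' j → e < ∑ j, T j →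
      (∀ b : Fin m → ℝ, (∀ j, b j ∈ S j) → ∑ j, b j ≠ e → e ≤ ∑ j, b j →
        ∃ c : Fin m → ℝ, (∀ j, c j ∈ S' j) ∧ ∑ j, c j = ∑ j, b j) →
      (∀ c : Fin m → ℝ, (∀ j, c j ∈ S' j) → ∑ j, c j ≠ e → e ≤ ∑ j, c j →
        ∃ b : Fin m → ℝ, (∀ j, b j ∈ S j) ∧ ∑ j, b j = ∑ j, c j) →
      4 ≤ (Finset.univ.filter fun i => a i ≠ T i).card → 4 ≤ (Finset.univ.filter fun i => u i ≠ T' i).card →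
      (∀ j, ∀ x ∈ S j, cf j x ≠ 0) → (∀ j, ∀ x ∈ S' j, cg j x ≠ 0) →
      (∀ b c : Fin m → ℝ, (∀ j, b j ∈ S j) → (∀ j, c j ∈ S' j) → ∑ j, b j = ∑ j, c j →
        ∑ j, b j ≠ e → e ≤ ∑ j, b j → ∏ j, cf j (b j) + ∏ j, cg j (c j) = 0) →
      ∏ j, cf j (a j) + ∏ j, cg j (u j) ≠ 0 →
      ∃ ψ ψ' : Fin m → ℝ → ℝ,
        (∀ b c : Fin m → ℝ, (∀ j, b j ∈ S j) → (∀ j, c j ∈ S' j) → ∑ j, b j = ∑ j, c j →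
          ∑ j, b j ≠ e → e ≤ ∑ j, b j → ∑ j, ψ j (b j) = ∑ j, ψ' j (c j)) ∧
        ∑ j, ψ j (a j) ≠ ∑ j, ψ' j (u j)) :
    ∀ (S S' : Fin m → Finset (Fin 2 →₀ ℕ)) (lc : (Fin 2 → ℝ) →L[ℝ] ℝ) (e : Fin 2 →₀ ℕ)
        (T T' a u : Fin m → (Fin 2 →₀ ℕ)) (cf cg : Fin m → (Fin 2 →₀ ℕ) → ℂ),
      (∀ b c : Fin m → (Fin 2 →₀ ℕ), (∀ j, b j ∈ S j) → (∀ j, c j ∈ S j) → ∑ j, b j = ∑ j, c j → b = c) →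
      (∀ b c : Fin m → (Fin 2 →₀ ℕ), (∀ j, b j ∈ S' j) → (∀ j, c j ∈ S' j) → ∑ j, b j = ∑ j, c j → b = c) →
      (∀ j, T j ∈ S j) → (∀ j, ∀ x ∈ S j, lexKey lc x ≤ lexKey lc (T j)) →
      (∀ j, T' j ∈ S' j) → (∀ j, ∀ x ∈ S' j, lexKey lc x ≤ lexKey lc (T' j)) →
      (∀ j, a j ∈ S j) → ∑ j, a j = e → (∀ j, u j ∈ S' j) → ∑ j, u j = e →
      ∑ j, T j = ∑ j, T' j → lexKey lc e < lexKey lc (∑ j, T j) →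
      (∀ b : Fin m → (Fin 2 →₀ ℕ), (∀ j, b j ∈ S j) → ∑ j, b j ≠ e → lc (emb e) ≤ lc (emb (∑ j, b j)) →
        ∃ c : Fin m → (Fin 2 →₀ ℕ), (∀ j, c j ∈ S' j) ∧ ∑ j, c j = ∑ j, b j) →
      (∀ c : Fin m → (Fin 2 →₀ ℕ), (∀ j, c j ∈ S' j) → ∑ j, c j ≠ e → lc (emb e) ≤ lc (emb (∑ j, c j)) →
        ∃ b : Fin m → (Fin 2 →₀ ℕ), (∀ j, b j ∈ S j) ∧ ∑ j, b j = ∑ j, c j) →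
      4 ≤ (Finset.univ.filter fun i => a i ≠ T i).card → 4 ≤ (Finset.univ.filter fun i => u i ≠ T' i).card →
      (∀ j, ∀ x ∈ S j, cf j x ≠ 0) → (∀ j, ∀ x ∈ S' j, cg j x ≠ 0) →
      (∀ b c : Fin m → (Fin 2 →₀ ℕ), (∀ j, b j ∈ S j) → (∀ j, c j ∈ S' j) → ∑ j, b j = ∑ j, c j →
        ∑ j, b j ≠ e → lc (emb e) ≤ lc (emb (∑ j, b j)) → ∏ j, cf j (b j) + ∏ j, cg j (c j) = 0) →
      ∏ j, cf j (a j) + ∏ j, cg j (u j) ≠ 0 →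
      ∃ (w : Fin m → (Fin 2 →₀ ℕ)) (p : Fin m) (y : Fin 2 →₀ ℕ), (∀ i, w i ∈ S' i) ∧
        (Finset.univ.filter fun i => w i ≠ T' i).card ≤ 2 ∧ y ∈ S' p ∧
        emb e = emb (∑ i, w i) - (emb (T' p) - emb y) := by
  intro S S' lc e T T' a u cf cg hS hS' hT hTmax hT' hTmax' ha hae hu hue htop hTe hwin hwin' h4 hu4 hcf hcg hcan hne
  set L : Finset (Fin 2 →₀ ℕ) := Finset.univ.biUnion S with hL
  set L' : Finset (Fin 2 →₀ ℕ) := Finset.univ.biUnion S' with hL'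
  set W : Finset (Fin 2 →₀ ℕ) := (Fintype.piFinset S).image fun b => ∑ j, b j with hW
  set W' : Finset (Fin 2 →₀ ℕ) := (Fintype.piFinset S').image fun c => ∑ j, c j with hW'
  set V : Finset (Fin 2 →₀ ℕ) := ((Fintype.piFinset S') ×ˢ L').image fun q => ∑ j, q.1 j + q.2 with hV
  set E : Finset (Fin 2 →₀ ℕ) := L'.image fun y => e + y with hE
  set F : Finset (Fin 2 →₀ ℕ) := L ∪ L' ∪ W ∪ W' ∪ {e} ∪ V ∪ E with hF
  have hLmem : ∀ j, ∀ x ∈ S j, x ∈ F := fun j x hx => by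
    rw [hF]; simp only [Finset.mem_union]
    exact Or.inl (Or.inl (Or.inl (Or.inl (Or.inl (Or.inl (by rw [hL, Finset.mem_biUnion]; exact ⟨j, Finset.mem_univ _, hx⟩))))))
  have hL'mem : ∀ j, ∀ x ∈ S' j, x ∈ F := fun j x hx => by
    rw [hF]; simp only [Finset.mem_union]
    exact Or.inl (Or.inl (Or.inl (Or.inl (Or.inl (Or.inr (by rw [hL', Finset.mem_biUnion]; exact ⟨j, Finset.mem_univ _, hx⟩))))))
  have hWmem : ∀ b : Fin m → (Fin 2 →₀ ℕ), (∀ j, b j ∈ S j) → ∑ j, b j ∈ F := fun b hb => by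
    rw [hF]; simp only [Finset.mem_union]
    refine Or.inl (Or.inl (Or.inl (Or.inl (Or.inr ?_))))
    rw [hW, Finset.mem_image]; exact ⟨b, Fintype.mem_piFinset.2 hb, rfl⟩
  have hW'mem : ∀ c : Fin m → (Fin 2 →₀ ℕ), (∀ j, c j ∈ S' j) → ∑ j, c j ∈ F := fun c hc => by
    rw [hF]; simp only [Finset.mem_union]
    refine Or.inl (Or.inl (Or.inl (Or.inr ?_)))
    rw [hW', Finset.mem_image]; exact ⟨c, Fintype.mem_piFinset.2 hc, rfl⟩
  have hemem : e ∈ F := by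
    rw [hF]; simp
  have hVmem : ∀ (c : Fin m → (Fin 2 →₀ ℕ)) (p : Fin m) (y : Fin 2 →₀ ℕ), (∀ j, c j ∈ S' j) → y ∈ S' p →
      ∑ j, c j + y ∈ F := fun c p y hc hy => by
    rw [hF]; simp only [Finset.mem_union]
    refine Or.inl (Or.inr ?_)
    rw [hV, Finset.mem_image]
    refine ⟨(c, y), Finset.mk_mem_product (Fintype.mem_piFinset.2 hc) ?_, rfl⟩
    rw [hL', Finset.mem_biUnion]; exact ⟨p, Finset.mem_univ _, hy⟩
  have hEmem : ∀ (p : Fin m) (y : Fin 2 →₀ ℕ), y ∈ S' p → e + y ∈ F := fun p y hy => by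
    rw [hF]; simp only [Finset.mem_union]
    refine Or.inr ?_
    rw [hE, Finset.mem_image]
    exact ⟨y, by rw [hL', Finset.mem_biUnion]; exact ⟨p, Finset.mem_univ _, hy⟩, rfl⟩
  obtain ⟨N, N', hmono⟩ := exists_keyMonotone lc F
  let φ : (Fin 2 →₀ ℕ) →+ ℝ :=
    { toFun := fun q => N * lc (emb q) + N' * ((q 0 : ℕ) : ℝ) + ((q 1 : ℕ) : ℝ)
      map_zero' := by
        have h0 : emb 0 = 0 := by funext i; simp [emb]
        simp [h0]
      map_add' := fun x y => by
        simp only [emb_add, map_add, Finsupp.add_apply, Nat.cast_add]; ring }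
  have hφ : ∀ q, φ q = N * lc (emb q) + N' * ((q 0 : ℕ) : ℝ) + ((q 1 : ℕ) : ℝ) := fun q => rfl
  have hlt : ∀ q ∈ F, ∀ q' ∈ F, lexKey lc q < lexKey lc q' → φ q < φ q' := fun q hq q' hq' h => by
    rw [hφ, hφ]; exact hmono q hq q' hq' h
  have hinj : ∀ q ∈ F, ∀ q' ∈ F, φ q = φ q' → q = q' := by
    intro q hq q' hq' h
    rcases lt_trichotomy (lexKey lc q) (lexKey lc q') with hlt' | heq | hgt
    · exact absurd h (hlt q hq q' hq' hlt').ne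
    · exact lexKey_injective lc heq
    · exact absurd h.symm (hlt q' hq' q hq hgt).ne
  have hle : ∀ q ∈ F, ∀ q' ∈ F, lexKey lc q ≤ lexKey lc q' → φ q ≤ φ q' := by
    intro q hq q' hq' h
    rcases h.lt_or_eq with h | h
    · exact (hlt q hq q' hq' h).le
    · rw [lexKey_injective lc h]
  have hkey_of_le : ∀ q ∈ F, ∀ q' ∈ F, φ q ≤ φ q' → lexKey lc q ≤ lexKey lc q' := by
    intro q hq q' hq' h
    by_contra hc
    exact absurd h (not_le.2 (hlt q' hq' q hq (not_le.1 hc)))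
  have hφsum : ∀ b : Fin m → (Fin 2 →₀ ℕ), φ (∑ j, b j) = ∑ j, φ (b j) := fun b => map_sum φ b Finset.univ
  set S1 : Fin m → Finset ℝ := fun j => (S j).image φ with hS1
  set S1' : Fin m → Finset ℝ := fun j => (S' j).image φ with hS1'
  have hS1d : ∀ b c : Fin m → ℝ, (∀ j, b j ∈ S1 j) → (∀ j, c j ∈ S1 j) → ∑ j, b j = ∑ j, c j → b = c := by
    intro b1 c1 hb1 hc1 hsum
    obtain ⟨b, hb, hbe⟩ := lift_word S φ b1 hb1
    obtain ⟨c, hc, hce⟩ := lift_word S φ c1 hc1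
    have h1 : φ (∑ j, b j) = φ (∑ j, c j) := by
      rw [hφsum, hφsum]
      calc ∑ j, φ (b j) = ∑ j, b1 j := Finset.sum_congr rfl fun j _ => hbe j
        _ = ∑ j, c1 j := hsum
        _ = ∑ j, φ (c j) := Finset.sum_congr rfl fun j _ => (hce j).symm
    have h2 : b = c := hS b c hb hc (hinj _ (hWmem b hb) _ (hWmem c hc) h1)
    funext j; rw [← hbe j, ← hce j, h2]
  have hS1'd : ∀ b c : Fin m → ℝ, (∀ j, b j ∈ S1' j) → (∀ j, c j ∈ S1' j) → ∑ j, b j = ∑ j, c j → b = c := by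
    intro b1 c1 hb1 hc1 hsum
    obtain ⟨b, hb, hbe⟩ := lift_word S' φ b1 hb1
    obtain ⟨c, hc, hce⟩ := lift_word S' φ c1 hc1
    have h1 : φ (∑ j, b j) = φ (∑ j, c j) := by
      rw [hφsum, hφsum]
      calc ∑ j, φ (b j) = ∑ j, b1 j := Finset.sum_congr rfl fun j _ => hbe j
        _ = ∑ j, c1 j := hsum
        _ = ∑ j, φ (c j) := Finset.sum_congr rfl fun j _ => (hce j).symm
    have h2 : b = c := hS' b c hb hc (hinj _ (hW'mem b hb) _ (hW'mem c hc) h1)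
    funext j; rw [← hbe j, ← hce j, h2]
  have hT1 : ∀ j, φ (T j) ∈ S1 j := fun j => Finset.mem_image_of_mem _ (hT j)
  have hT1max : ∀ j, ∀ x ∈ S1 j, x ≤ φ (T j) := by
    intro j x1 hx1
    obtain ⟨x, hx, rfl⟩ := Finset.mem_image.1 hx1
    exact hle x (hLmem j x hx) (T j) (hLmem j _ (hT j)) (hTmax j x hx)
  have hT1' : ∀ j, φ (T' j) ∈ S1' j := fun j => Finset.mem_image_of_mem _ (hT' j)
  have hT1max' : ∀ j, ∀ x ∈ S1' j, x ≤ φ (T' j) := by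
    intro j x1 hx1
    obtain ⟨x, hx, rfl⟩ := Finset.mem_image.1 hx1
    exact hle x (hL'mem j x hx) (T' j) (hL'mem j _ (hT' j)) (hTmax' j x hx)
  have ha1 : ∀ j, φ (a j) ∈ S1 j := fun j => Finset.mem_image_of_mem _ (ha j)
  have hae1 : ∑ j, φ (a j) = φ e := by rw [← hφsum, hae]
  have htop1 : ∑ j, φ (T j) = ∑ j, φ (T' j) := by rw [← hφsum, ← hφsum, htop]
  have hTe1 : φ e < ∑ j, φ (T j) := by
    rw [← hφsum]; exact hlt e hemem _ (hWmem T hT) hTe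
  have hwin1 : ∀ b : Fin m → ℝ, (∀ j, b j ∈ S1 j) → ∑ j, b j ≠ φ e → φ e ≤ ∑ j, b j →
      ∃ c : Fin m → ℝ, (∀ j, c j ∈ S1' j) ∧ ∑ j, c j = ∑ j, b j := by
    intro b1 hb1 hne hge
    obtain ⟨b, hb, hbe⟩ := lift_word S φ b1 hb1
    have hsum : ∑ j, b1 j = φ (∑ j, b j) := by
      rw [hφsum]; exact Finset.sum_congr rfl fun j _ => (hbe j).symm
    rw [hsum] at hne hge
    have hne' : ∑ j, b j ≠ e := fun h => hne (by rw [h])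
    have hkey := hkey_of_le e hemem _ (hWmem b hb) hge
    obtain ⟨c, hc, hcs⟩ := hwin b hb hne' (apply_le_of_lexKey_le lc hkey)
    refine ⟨fun j => φ (c j), fun j => Finset.mem_image_of_mem _ (hc j), ?_⟩
    rw [hsum, ← hφsum, hcs]
  have hwin1' : ∀ c : Fin m → ℝ, (∀ j, c j ∈ S1' j) → ∑ j, c j ≠ φ e → φ e ≤ ∑ j, c j →
      ∃ b : Fin m → ℝ, (∀ j, b j ∈ S1 j) ∧ ∑ j, b j = ∑ j, c j := by
    intro c1 hc1 hne hge
    obtain ⟨c, hc, hce⟩ := lift_word S' φ c1 hc1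
    have hsum : ∑ j, c1 j = φ (∑ j, c j) := by
      rw [hφsum]; exact Finset.sum_congr rfl fun j _ => (hce j).symm
    rw [hsum] at hne hge
    have hne' : ∑ j, c j ≠ e := fun h => hne (by rw [h])
    have hkey := hkey_of_le e hemem _ (hW'mem c hc) hge
    obtain ⟨b, hb, hbs⟩ := hwin' c hc hne' (apply_le_of_lexKey_le lc hkey)
    refine ⟨fun j => φ (b j), fun j => Finset.mem_image_of_mem _ (hb j), ?_⟩
    rw [hsum, ← hφsum, hbs]
  have hfilt : (Finset.univ.filter fun i => φ (a i) ≠ φ (T i)) = (Finset.univ.filter fun i => a i ≠ T i) := by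
    ext i
    simp only [Finset.mem_filter, Finset.mem_univ, true_and]
    exact ⟨fun h hc => h (by rw [hc]), fun h hc => h (hinj _ (hLmem i _ (ha i)) _ (hLmem i _ (hT i)) hc)⟩
  have h41 : 4 ≤ (Finset.univ.filter fun i => φ (a i) ≠ φ (T i)).card := by rw [hfilt]; exact h4
  have hua1 : ∀ j, φ (u j) ∈ S1' j := fun j => Finset.mem_image_of_mem _ (hu j)
  have hue1 : ∑ j, φ (u j) = φ e := by rw [← hφsum, hue]
  have hfilt' : (Finset.univ.filter fun i => φ (u i) ≠ φ (T' i)) = (Finset.univ.filter fun i => u i ≠ T' i) := by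
    ext i
    simp only [Finset.mem_filter, Finset.mem_univ, true_and]
    exact ⟨fun h hc => h (by rw [hc]), fun h hc => h (hinj _ (hL'mem i _ (hu i)) _ (hL'mem i _ (hT' i)) hc)⟩
  have hu41 : 4 ≤ (Finset.univ.filter fun i => φ (u i) ≠ φ (T' i)).card := by rw [hfilt']; exact hu4
  have hinjS : ∀ j, ∀ x ∈ S j, ∀ x' ∈ S j, φ x = φ x' → x = x' :=
    fun j x hx x' hx' h => hinj x (hLmem j x hx) x' (hLmem j x' hx') h
  have hinjS' : ∀ j, ∀ x ∈ S' j, ∀ x' ∈ S' j, φ x = φ x' → x = x' :=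
    fun j x hx x' hx' h => hinj x (hL'mem j x hx) x' (hL'mem j x' hx') h
  set cf1 : Fin m → ℝ → ℂ := fun j x1 => if h : ∃ x ∈ S j, φ x = x1 then cf j h.choose else 1 with hcf1
  set cg1 : Fin m → ℝ → ℂ := fun j x1 => if h : ∃ x ∈ S' j, φ x = x1 then cg j h.choose else 1 with hcg1
  have hcf1e : ∀ j, ∀ x ∈ S j, cf1 j (φ x) = cf j x := by
    intro j x hx
    have h : ∃ x' ∈ S j, φ x' = φ x := ⟨x, hx, rfl⟩
    rw [hcf1]; dsimp only; rw [dif_pos h]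
    congr 1; exact hinjS j _ h.choose_spec.1 _ hx h.choose_spec.2
  have hcg1e : ∀ j, ∀ x ∈ S' j, cg1 j (φ x) = cg j x := by
    intro j x hx
    have h : ∃ x' ∈ S' j, φ x' = φ x := ⟨x, hx, rfl⟩
    rw [hcg1]; dsimp only; rw [dif_pos h]
    congr 1; exact hinjS' j _ h.choose_spec.1 _ hx h.choose_spec.2
  have hcf1 : ∀ j, ∀ x ∈ S1 j, cf1 j x ≠ 0 := by
    intro j x1 hx1
    obtain ⟨x, hx, rfl⟩ := Finset.mem_image.1 hx1
    rw [hcf1e j x hx]; exact hcf j x hx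
  have hcg1 : ∀ j, ∀ x ∈ S1' j, cg1 j x ≠ 0 := by
    intro j x1 hx1
    obtain ⟨x, hx, rfl⟩ := Finset.mem_image.1 hx1
    rw [hcg1e j x hx]; exact hcg j x hx
  have hcan1 : ∀ b c : Fin m → ℝ, (∀ j, b j ∈ S1 j) → (∀ j, c j ∈ S1' j) → ∑ j, b j = ∑ j, c j →
      ∑ j, b j ≠ φ e → φ e ≤ ∑ j, b j → ∏ j, cf1 j (b j) + ∏ j, cg1 j (c j) = 0 := by
    intro b1 c1 hb1 hc1 hbc hne hge
    obtain ⟨b, hb, hbe⟩ := lift_word S φ b1 hb1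
    obtain ⟨c, hc, hce⟩ := lift_word S' φ c1 hc1
    have hsb : ∑ j, b1 j = φ (∑ j, b j) := by
      rw [hφsum]; exact Finset.sum_congr rfl fun j _ => (hbe j).symm
    have hsc : ∑ j, c1 j = φ (∑ j, c j) := by
      rw [hφsum]; exact Finset.sum_congr rfl fun j _ => (hce j).symm
    rw [hsb] at hne hge hbc
    rw [hsc] at hbc
    have hbc' : ∑ j, b j = ∑ j, c j := hinj _ (hWmem b hb) _ (hW'mem c hc) hbc
    have hne' : ∑ j, b j ≠ e := fun h => hne (by rw [h])
    have hkey := hkey_of_le e hemem _ (hWmem b hb) hge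
    have h := hcan b c hb hc hbc' hne' (apply_le_of_lexKey_le lc hkey)
    have e1 : ∏ j, cf1 j (b1 j) = ∏ j, cf j (b j) :=
      Finset.prod_congr rfl fun j _ => by rw [← hbe j]; exact hcf1e j _ (hb j)
    have e2 : ∏ j, cg1 j (c1 j) = ∏ j, cg j (c j) :=
      Finset.prod_congr rfl fun j _ => by rw [← hce j]; exact hcg1e j _ (hc j)
    rw [e1, e2]; exact h
  have hne1 : ∏ j, cf1 j (φ (a j)) + ∏ j, cg1 j (φ (u j)) ≠ 0 := by
    rw [Finset.prod_congr rfl fun j _ => hcf1e j _ (ha j), Finset.prod_congr rfl fun j _ => hcg1e j _ (hu j)]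
    exact hne
  obtain ⟨ψ, ψ', hcons, hsep⟩ := hSep1D S1 S1' (φ e) (fun j => φ (T j)) (fun j => φ (T' j)) (fun j => φ (a j))
    (fun j => φ (u j)) cf1 cg1 hS1d hS1'd hT1 hT1max hT1' hT1max' ha1 hae1 hua1 hue1 htop1 hTe1 hwin1 hwin1' h41 hu41
    hcf1 hcg1 hcan1 hne1
  obtain ⟨w1, p, y1, hw1, hw1c, hy1, hEq⟩ := certificate_of_out1D_of_separation hOut1D S1 S1' (φ e)
    (fun j => φ (T j)) (fun j => φ (T' j)) (fun j => φ (a j)) (fun j => φ (u j)) ψ ψ' hS1d hS1'd hT1 hT1max hT1'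
    hT1max' ha1 hae1 hua1 hue1 htop1 hTe1 hwin1 hwin1' h41 hcons hsep
  obtain ⟨w, hw, hwe⟩ := lift_word S' φ w1 hw1
  obtain ⟨y, hy, hye⟩ := Finset.mem_image.1 hy1
  refine ⟨w, p, y, hw, ?_, hy, ?_⟩
  · have hfw : (Finset.univ.filter fun i => w i ≠ T' i) = (Finset.univ.filter fun i => w1 i ≠ φ (T' i)) := by
      ext i
      simp only [Finset.mem_filter, Finset.mem_univ, true_and]
      rw [← hwe i]
      exact ⟨fun h hc => h (hinj _ (hL'mem i _ (hw i)) _ (hL'mem i _ (hT' i)) hc), fun h hc => h (by rw [hc])⟩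
    rw [hfw]; exact hw1c
  · have h1 : φ (e + T' p) = φ (∑ i, w i + y) := by
      rw [map_add, map_add, hEq, hφsum, hye]
      congr 1
      exact Finset.sum_congr rfl fun j _ => (hwe j).symm
    have h2 : e + T' p = ∑ i, w i + y := hinj _ (hEmem p _ (hT' p)) _ (hVmem w p y hw hy) h1
    have h3 : emb e + emb (T' p) = emb (∑ i, w i) + emb y := by rw [← emb_add, ← emb_add, h2]
    rw [show emb e = emb (∑ i, w i) + emb y - emb (T' p) by rw [← h3]; abel]; abel

/-- **(IX) from the 1-D OUT kernel and the separation kernel**: `hIX` of `crossCancel_of_shallowNeighbour` (p603280) VERBATIM, for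
dissociated `f`, `g`. [ours] -/
theorem shallowNeighbour_of_out1D_of_sep1D (f g : Fin m → MvPolynomial (Fin 2) ℂ)
    (hinjf : ∀ a b : Fin m → (Fin 2 →₀ ℕ), (∀ j, a j ∈ (f j).support) → (∀ j, b j ∈ (f j).support) →
      ∑ j, a j = ∑ j, b j → a = b)
    (hinjg : ∀ a b : Fin m → (Fin 2 →₀ ℕ), (∀ j, a j ∈ (g j).support) → (∀ j, b j ∈ (g j).support) →
      ∑ j, a j = ∑ j, b j → a = b)
    (hOut1D : ∀ (S S' : Fin m → Finset ℝ) (e : ℝ) (T T' a : Fin m → ℝ),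
      (∀ b c : Fin m → ℝ, (∀ j, b j ∈ S j) → (∀ j, c j ∈ S j) → ∑ j, b j = ∑ j, c j → b = c) →
      (∀ b c : Fin m → ℝ, (∀ j, b j ∈ S' j) → (∀ j, c j ∈ S' j) → ∑ j, b j = ∑ j, c j → b = c) →
      (∀ j, T j ∈ S j) → (∀ j, ∀ x ∈ S j, x ≤ T j) → (∀ j, T' j ∈ S' j) → (∀ j, ∀ x ∈ S' j, x ≤ T' j) →
      (∀ j, a j ∈ S j) → ∑ j, a j = e → ∑ j, T j = ∑ j, T' j → e < ∑ j, T j →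
      (∀ b : Fin m → ℝ, (∀ j, b j ∈ S j) → ∑ j, b j ≠ e → e ≤ ∑ j, b j →
        ∃ c : Fin m → ℝ, (∀ j, c j ∈ S' j) ∧ ∑ j, c j = ∑ j, b j) →
      (∀ c : Fin m → ℝ, (∀ j, c j ∈ S' j) → ∑ j, c j ≠ e → e ≤ ∑ j, c j →
        ∃ b : Fin m → ℝ, (∀ j, b j ∈ S j) ∧ ∑ j, b j = ∑ j, c j) →
      (∀ c : Fin m → ℝ, (∀ j, c j ∈ S' j) → ∑ j, c j ≠ e) →
      4 ≤ (Finset.univ.filter fun i => a i ≠ T i).card →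
      ∃ (w : Fin m → ℝ) (p : Fin m) (y : ℝ), (∀ i, w i ∈ S' i) ∧
        (Finset.univ.filter fun i => w i ≠ T' i).card ≤ 2 ∧ y ∈ S' p ∧ e + T' p = ∑ i, w i + y)
    (hSep1D : ∀ (S S' : Fin m → Finset ℝ) (e : ℝ) (T T' a u : Fin m → ℝ) (cf cg : Fin m → ℝ → ℂ),
      (∀ b c : Fin m → ℝ, (∀ j, b j ∈ S j) → (∀ j, c j ∈ S j) → ∑ j, b j = ∑ j, c j → b = c) →
      (∀ b c : Fin m → ℝ, (∀ j, b j ∈ S' j) → (∀ j, c j ∈ S' j) → ∑ j, b j = ∑ j, c j → b = c) →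
      (∀ j, T j ∈ S j) → (∀ j, ∀ x ∈ S j, x ≤ T j) → (∀ j, T' j ∈ S' j) → (∀ j, ∀ x ∈ S' j, x ≤ T' j) →
      (∀ j, a j ∈ S j) → ∑ j, a j = e → (∀ j, u j ∈ S' j) → ∑ j, u j = e →
      ∑ j, T j = ∑ j, T' j → e < ∑ j, T j →
      (∀ b : Fin m → ℝ, (∀ j, b j ∈ S j) → ∑ j, b j ≠ e → e ≤ ∑ j, b j →
        ∃ c : Fin m → ℝ, (∀ j, c j ∈ S' j) ∧ ∑ j, c j = ∑ j, b j) →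
      (∀ c : Fin m → ℝ, (∀ j, c j ∈ S' j) → ∑ j, c j ≠ e → e ≤ ∑ j, c j →
        ∃ b : Fin m → ℝ, (∀ j, b j ∈ S j) ∧ ∑ j, b j = ∑ j, c j) →
      4 ≤ (Finset.univ.filter fun i => a i ≠ T i).card → 4 ≤ (Finset.univ.filter fun i => u i ≠ T' i).card →
      (∀ j, ∀ x ∈ S j, cf j x ≠ 0) → (∀ j, ∀ x ∈ S' j, cg j x ≠ 0) →
      (∀ b c : Fin m → ℝ, (∀ j, b j ∈ S j) → (∀ j, c j ∈ S' j) → ∑ j, b j = ∑ j, c j →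
        ∑ j, b j ≠ e → e ≤ ∑ j, b j → ∏ j, cf j (b j) + ∏ j, cg j (c j) = 0) →
      ∏ j, cf j (a j) + ∏ j, cg j (u j) ≠ 0 →
      ∃ ψ ψ' : Fin m → ℝ → ℝ,
        (∀ b c : Fin m → ℝ, (∀ j, b j ∈ S j) → (∀ j, c j ∈ S' j) → ∑ j, b j = ∑ j, c j →
          ∑ j, b j ≠ e → e ≤ ∑ j, b j → ∑ j, ψ j (b j) = ∑ j, ψ' j (c j)) ∧
        ∑ j, ψ j (a j) ≠ ∑ j, ψ' j (u j)) :
    ∀ (lc : (Fin 2 → ℝ) →L[ℝ] ℝ) (e : Fin 2 →₀ ℕ) (T T' a : Fin m → (Fin 2 →₀ ℕ)),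
      (∀ j, T j ∈ (f j).support) → (∀ j, ∀ x ∈ (f j).support, lexKey lc x ≤ lexKey lc (T j)) →
      (∀ j, T' j ∈ (g j).support) → (∀ j, ∀ x ∈ (g j).support, lexKey lc x ≤ lexKey lc (T' j)) →
      (∀ j, a j ∈ (f j).support) → ∑ j, a j = e →
      (∀ x : Fin 2 →₀ ℕ, x ≠ e → lc (emb e) ≤ lc (emb x) → coeff x (∏ j, f j) + coeff x (∏ j, g j) = 0) →
      coeff e (∏ j, f j) + coeff e (∏ j, g j) ≠ 0 → ∑ j, T j = ∑ j, T' j → lexKey lc e < lexKey lc (∑ j, T j) →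
      (Finset.univ.filter fun i => a i ≠ T i).card ≤ 3 ∨
        ∃ (w : Fin m → (Fin 2 →₀ ℕ)) (p : Fin m) (y : Fin 2 →₀ ℕ), (∀ i, w i ∈ (g i).support) ∧
          (Finset.univ.filter fun i => w i ≠ T' i).card ≤ 2 ∧ y ∈ (g p).support ∧
          emb e = emb (∑ i, w i) - (emb (T' p) - emb y) :=
  shallowNeighbour_of_cores f g hinjf hinjg (outKernel_of_oneD hOut1D) (bothKernel_of_oneD_of_sep hOut1D hSep1D)

/-- **The `k = 2` cross-cancelling count from the 1-D OUT kernel and the separation kernel.** [ours] -/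
theorem crossCancel_of_out1D_of_sep1D (m t : ℕ) (A B : Fin m → Finset (Fin 2 →₀ ℕ))
    (f g : Fin m → MvPolynomial (Fin 2) ℂ)
    (hA : ∀ j, (A j).card ≤ t) (hB : ∀ j, (B j).card ≤ t)
    (hf : ∀ j, (f j).support ⊆ A j) (hg : ∀ j, (g j).support ⊆ B j)
    (hinjA : ∀ a b : Fin m → (Fin 2 →₀ ℕ), (∀ j, a j ∈ A j) → (∀ j, b j ∈ A j) → ∑ j, a j = ∑ j, b j → a = b)
    (hinjB : ∀ a b : Fin m → (Fin 2 →₀ ℕ), (∀ j, a j ∈ B j) → (∀ j, b j ∈ B j) → ∑ j, a j = ∑ j, b j → a = b)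
    (hOut1D : ∀ (S S' : Fin m → Finset ℝ) (e : ℝ) (T T' a : Fin m → ℝ),
      (∀ b c : Fin m → ℝ, (∀ j, b j ∈ S j) → (∀ j, c j ∈ S j) → ∑ j, b j = ∑ j, c j → b = c) →
      (∀ b c : Fin m → ℝ, (∀ j, b j ∈ S' j) → (∀ j, c j ∈ S' j) → ∑ j, b j = ∑ j, c j → b = c) →
      (∀ j, T j ∈ S j) → (∀ j, ∀ x ∈ S j, x ≤ T j) → (∀ j, T' j ∈ S' j) → (∀ j, ∀ x ∈ S' j, x ≤ T' j) →
      (∀ j, a j ∈ S j) → ∑ j, a j = e → ∑ j, T j = ∑ j, T' j → e < ∑ j, T j →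
      (∀ b : Fin m → ℝ, (∀ j, b j ∈ S j) → ∑ j, b j ≠ e → e ≤ ∑ j, b j →
        ∃ c : Fin m → ℝ, (∀ j, c j ∈ S' j) ∧ ∑ j, c j = ∑ j, b j) →
      (∀ c : Fin m → ℝ, (∀ j, c j ∈ S' j) → ∑ j, c j ≠ e → e ≤ ∑ j, c j →
        ∃ b : Fin m → ℝ, (∀ j, b j ∈ S j) ∧ ∑ j, b j = ∑ j, c j) →
      (∀ c : Fin m → ℝ, (∀ j, c j ∈ S' j) → ∑ j, c j ≠ e) →
      4 ≤ (Finset.univ.filter fun i => a i ≠ T i).card →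
      ∃ (w : Fin m → ℝ) (p : Fin m) (y : ℝ), (∀ i, w i ∈ S' i) ∧
        (Finset.univ.filter fun i => w i ≠ T' i).card ≤ 2 ∧ y ∈ S' p ∧ e + T' p = ∑ i, w i + y)
    (hSep1D : ∀ (S S' : Fin m → Finset ℝ) (e : ℝ) (T T' a u : Fin m → ℝ) (cf cg : Fin m → ℝ → ℂ),
      (∀ b c : Fin m → ℝ, (∀ j, b j ∈ S j) → (∀ j, c j ∈ S j) → ∑ j, b j = ∑ j, c j → b = c) →
      (∀ b c : Fin m → ℝ, (∀ j, b j ∈ S' j) → (∀ j, c j ∈ S' j) → ∑ j, b j = ∑ j, c j → b = c) →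
      (∀ j, T j ∈ S j) → (∀ j, ∀ x ∈ S j, x ≤ T j) → (∀ j, T' j ∈ S' j) → (∀ j, ∀ x ∈ S' j, x ≤ T' j) →
      (∀ j, a j ∈ S j) → ∑ j, a j = e → (∀ j, u j ∈ S' j) → ∑ j, u j = e →
      ∑ j, T j = ∑ j, T' j → e < ∑ j, T j →
      (∀ b : Fin m → ℝ, (∀ j, b j ∈ S j) → ∑ j, b j ≠ e → e ≤ ∑ j, b j →
        ∃ c : Fin m → ℝ, (∀ j, c j ∈ S' j) ∧ ∑ j, c j = ∑ j, b j) →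
      (∀ c : Fin m → ℝ, (∀ j, c j ∈ S' j) → ∑ j, c j ≠ e → e ≤ ∑ j, c j →
        ∃ b : Fin m → ℝ, (∀ j, b j ∈ S j) ∧ ∑ j, b j = ∑ j, c j) →
      4 ≤ (Finset.univ.filter fun i => a i ≠ T i).card → 4 ≤ (Finset.univ.filter fun i => u i ≠ T' i).card →
      (∀ j, ∀ x ∈ S j, cf j x ≠ 0) → (∀ j, ∀ x ∈ S' j, cg j x ≠ 0) →
      (∀ b c : Fin m → ℝ, (∀ j, b j ∈ S j) → (∀ j, c j ∈ S' j) → ∑ j, b j = ∑ j, c j →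
        ∑ j, b j ≠ e → e ≤ ∑ j, b j → ∏ j, cf j (b j) + ∏ j, cg j (c j) = 0) →
      ∏ j, cf j (a j) + ∏ j, cg j (u j) ≠ 0 →
      ∃ ψ ψ' : Fin m → ℝ → ℝ,
        (∀ b c : Fin m → ℝ, (∀ j, b j ∈ S j) → (∀ j, c j ∈ S' j) → ∑ j, b j = ∑ j, c j →
          ∑ j, b j ≠ e → e ≤ ∑ j, b j → ∑ j, ψ j (b j) = ∑ j, ψ' j (c j)) ∧
        ∑ j, ψ j (a j) ≠ ∑ j, ψ' j (u j)) :
    {p : Fin 2 → ℝ | p ∈ Set.extremePoints ℝ (convexHull ℝ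
          (emb '' ((∏ j, f j + ∏ j, g j).support : Set (Fin 2 →₀ ℕ)))) ∧
        ∃ l : (Fin 2 → ℝ) →ₗ[ℝ] ℝ,
          (∀ q ∈ emb '' ((∏ j, f j + ∏ j, g j).support : Set (Fin 2 →₀ ℕ)), q ≠ p → l q < l p) ∧
          ∃ q ∈ emb '' ((∏ j, f j).support : Set (Fin 2 →₀ ℕ)) ∪ emb '' ((∏ j, g j).support : Set (Fin 2 →₀ ℕ)),
            l p < l q}.ncard ≤ (m * t + 2) ^ 8 :=
  crossCancel_of_cores m t A B f g hA hB hf hg hinjA hinjB (outKernel_of_oneD hOut1D) (bothKernel_of_oneD_of_sep hOut1D hSep1D)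

end SepKernel

end

end Summit.ValiantsHypothesis.ValiantsHypothesis.Theorems.NewtonFramesTwoProducts.FrameRungTwoTrinomial
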